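import Summits.QuantumFields.BalabanUV.T4Continuum.Spine.NE3.PairLandauB8EndSfClass
import Summits.QuantumFields.BalabanUV.T4Continuum.Spine.NE3.TangentProjectionSlicB8Class
import HarnessLib

/-!
# T⁴ programme, node NE3 — THE END ON B8's SURFACE OVER `sfClass` WITH THE TANGENT PROJECTION BOUND DISCHARGED (census R25 ✓):
# covariant root ⇐ `PairLandauGaugeB8Avg` ∧ per-pair supplier on `slicB8` ∧ (P♮) on `slicB8` ∧ k-free letters — no `TangentProjectionBound` binder

Cell `pub-balaban-gaps` (YM blitz, track G2, seat `ne3`, unit `pub-balaban-gaps-ne3`; writer prover-pub-balaban-gaps-ne3-g4-0, 2026-08-23), census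
`run/shared/lean/pub/pub-balaban-gaps/ne/NE3.md` §4 R25 ∕ §10.  Inputs BY NAME: `Spine/NE3/PairLandauB8EndSfClass.ne3EnergyRateWCov_sfClass_of_pairLandauGaugeB8Avg`
(p343077: the `sfClass` END on B8's surface, whose per-pair binder `hsupp` carries the hypothesis SHAPE `TangentProjectionBound L (j+1) W (slicB8 …) {skew ∧
periodic ∧ TangentIter L j W} K …`) and `Spine/NE3/TangentProjectionSlicB8Class.tangentProjectionBound_slicB8_sfClass_family` (gen 4: that bound PROVED at every
pair with the k-free, N-free constant `K₂₅ := 1 + √(192·(d·L)·(d + #(Plane d)))`, from the class lines alone — corner-spike gauge correction of the accumulated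
frames, `Spine/NE3/TangentProjectionSlicB8`).

CONTENT (0 sorry, no `def`): **`ne3EnergyRateWCov_sfClass_of_pairLandauGaugeB8Avg_R25`** — VERBATIM the `sfClass` END with the `TangentProjectionBound` conjunct
REMOVED from `hsupp` and `K` REPLACED by `K₂₅`, at the price of the kinematic regime `3 ≤ d`, `2 ≤ L`, `ε ≤ 1` and the three class lines `hbs`, `hbε'`
(`MinimalActionRate.rescale_bavg_mem_sfClass`) and `h1`∕`h2` (`NE3ClassRadiusFamily.levelSmall_family`'s two ε-lines, which also DISCHARGE row Y9's multi-level
smallness `hsmall`).  What the END still displays per pair: the SUPPLIER `DecomposedRepT … (slicB8 …) …` with `pathΓ X N 0 = Z` and its (J1)∕(J2) lines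
(census R24: in kernel modulo the Landau-correction sup shape F5 and the Π-REG majorant F6 — `SupplierB8Level`), and (P♮) on `slicB8`
([Balaban1985BackgroundPropagators] Thm 3.3 TYPE).

HONEST FRAMING.  An implication; `PairLandauGaugeB8Avg` ([Balaban1985RegularSpaces] Thm 2 ∘ [Balaban1985Variational] Thm 1 TYPE), the supplier's inputs and (P♮)
are OPEN for Bałaban's minimisers; NOTHING of Bałaban's is proved; the covariant root and **NE3 are NOT proved**; spine PROVED 0∕9; finite T⁴ rung (B)+1 — NOT
continuum YM on ℝ⁴, NOT infinite volume, NOT mass gap, NOT `BetaPertH`, NOT Clay.  ABSOLUTE RULE kept.  PLACEMENT: `Summits/QuantumFields/BalabanUV/T4Continuum/Spine/NE3/`;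
imports accepted modules only; moves nothing.
-/

set_option autoImplicit false

open scoped BigOperators Matrix Matrix.Norms.L2Operator
open NormedSpace Finset

namespace Summit.QuantumFields.BalabanUV.T4Continuum.NE3.PairLandauB8EndSfClassR25

open Set
open Literature.MathematicalPhysics.QuantumFieldTheory.Balaban1983to89
open B7Prop1Explicit B7Prop2Explicit
open T4AveragingDeficitWall hiding Site Plane Plaq Bond
open T4AveragingDeficitWallBoundary (IsPeriodicCfg periodBox)
open AveragingDeficitPeriodicCounting (IsPeriodicDir)
open AveragingDeficitChartCalculus (cavg)
open AveragingDeficitMultiLevelPrep (LevelSmall TangentIter)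
open AveragingDeficitTwoLevelPrep (twoLevelSmall)
open MinimalActionSandwich (IsMinimiser)
open MinimalActionRate (Regular sfClass)
open NE3EnergyWeightedCovShape (NE3EnergyRateWCov)
open NE3SlicePoincareShape (SlicePoincare)
open NE3EnergyRateWSupOfSlicePoincare (cLambda)
open NE3ClassRadiusFamily (levelSmall_family)
open NE3ProductPath (pathΓ)
open NE3ProductPathChartSlice (DecomposedRepT)
open NE3.PairLandauB8Avg (LandauRepB8Avg PairLandauGaugeB8Avg slicB8)
open NE3.PairLandauB8EndSfClass (ne3EnergyRateWCov_sfClass_of_pairLandauGaugeB8Avg)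
open NE3.TangentProjectionSlicB8Class (tangentProjectionBound_slicB8_sfClass_family)

noncomputable section

variable {d : ℕ} {n : Type*} [Fintype n] [DecidableEq n]

/-- **THE END ON B8's SURFACE OVER `sfClass`, TANGENT PROJECTION BOUND DISCHARGED** (`3 ≤ d`, `2 ≤ L`, `1 ≤ N`, `0 ≤ b < ε ≤ 1`, `g > 0`, the class lines
`hbs`, `hbε'`, `h1`, `h2`): `NE3EnergyRateWCov d (sfClass d L N ε) L N b g ((1+θ₀)(4∕cΛ)(K₂₅·C′_{R♯5d})) s₁ s₂ dom` with
`K₂₅ = 1 + √(192·(d·L)·(d + #(Plane d)))` from `PairLandauGaugeB8Avg`, the per-pair supplier `DecomposedRepT` on `slicB8` starting at the B8 direction with its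
(J1)∕(J2) lines, and (P♮) on `slicB8` — the binder `TangentProjectionBound …` of `ne3EnergyRateWCov_sfClass_of_pairLandauGaugeB8Avg` is supplied by
`tangentProjectionBound_slicB8_sfClass_family`, row Y9's `hsmall` by `levelSmall_family`. [folklore] -/
theorem ne3EnergyRateWCov_sfClass_of_pairLandauGaugeB8Avg_R25 [Nonempty n] (hd : 3 ≤ d) {L N : ℕ} [NeZero L] [NeZero N] (hL : 2 ≤ L)
    (hN : 1 ≤ N) {ε b g : ℝ} (hb : 0 ≤ b) (hbε : b < ε) (hε1 : ε ≤ 1) (hg : 0 < g)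
    (hbs : 512 * (d + 1) * (d + 4) * (L : ℝ) ^ 2 * b ≤ 1) (hbε' : b + 226 * (8 * (d + 1) * (d + 4)) ^ 2 * b ^ 2 ≤ ε)
    (h1 : 16 * (14464 * ((d : ℝ) + 1) ^ 2 * ((d : ℝ) + 4) ^ 2) * ε ≤ 3) (h2 : 2 * twoLevelSmall d L * ε ≤ (L : ℝ) ^ 2)
    {dom : Set (Site d → Fin d → (Matrix n n ℂ)ˣ)} {s₁ s₂ ν κ₁ κ₂ CP Λ : ℝ}
    (hCP : 0 ≤ CP) (hreg₁ : CP * (Real.sqrt Λ - 1) ^ 2 ≤ 1 / 4) (hν : 0 ≤ ν)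
    (hbudget : 2 * Λ * (2 * (1 + 4 * Real.sqrt (16 * d + 1)) * ν) + Λ * (2 * (1 + 4 * Real.sqrt (16 * d + 1)) * ν) ^ 2
        + (2 * κ₁ + 912 * d * κ₂) ≤ cLambda n CP Λ / 2)
    (hB8 : PairLandauGaugeB8Avg d (sfClass d L N ε) L N b g s₁ s₂ 1 dom)
    (hsupp : ∀ j : ℕ, ∀ V ∈ dom, ∀ UA UB : Site d → Fin d → (Matrix n n ℂ)ˣ,
      IsMinimiser d (sfClass d L N ε) L N (j + 1) V UA → IsMinimiser d (sfClass d L N ε) L N (j + 2) V UB → Regular d L N b g (j + 2) UB →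
      ∀ (u : Site d → (Matrix n n ℂ)ˣ) (Z : Site d → Fin d → Matrix n n ℂ), LandauRepB8Avg L N (j + 1) (cavg L UB) UA u Z s₁ s₂ 1 →
        ∃ (X Nn : Site d → Fin d → Matrix n n ℂ) (α αN a : ℝ),
          DecomposedRepT (sfClass d L N ε) L N (j + 1) V UA UB u X Nn (slicB8 L N (j + 1) (cavg L UB)) α αN ν κ₁ κ₂ a ∧
          pathΓ X Nn 0 = Z ∧ α ≤ 1 / 40 ∧ αN ≤ 1 / 100 ∧
          (1 + 24 * Real.sqrt d * (Real.exp (10 * (α + αN)) - 1) * (L : ℝ) ^ (j + 1)) ^ 2 + 48 * d * a * ((L : ℝ) ^ (j + 1)) ^ 2 ≤ Λ ∧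
          112 * (d : ℝ) * a * CP * ((L : ℝ) ^ (j + 1)) ^ 2 ≤ 1 / (2 * (Fintype.card n : ℝ)) ∧
          SlicePoincare L (j + 1) (cavg L UB) (slicB8 L N (j + 1) (cavg L UB)) CP (periodBox (N * L ^ (j + 1)))) :
    NE3EnergyRateWCov d (sfClass d L N ε) L N b g
      ((1 + (ν + 23 * Real.sqrt 2 * Real.sqrt (16 * d + 1) * (1 + ν))) * (4 / cLambda n CP Λ)
        * ((1 + Real.sqrt (192 * ((d : ℝ) * L) * (d + Fintype.card (T4AveragingDeficitWall.Plane d))))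
          * (Real.sqrt ((L : ℝ) ^ (d - 2))
            + (Real.sqrt ((L : ℝ) ^ (d - 2)) * Real.sqrt (8 * Fintype.card (T4AveragingDeficitWall.Plane d))
                * (128 * (d * (L : ℝ) ^ 2))
              + 2 * (2048 * ((d : ℝ) + 4) ^ 2 * (L : ℝ) ^ 2 * Real.sqrt (d * (L : ℝ) ^ d))) * b
            + b ^ 2 * (2 * (L : ℝ) ^ (d - 1) + 2 * (8 * d * (L : ℝ) ^ d)) * Real.sqrt (d / (g * (L : ℝ) ^ (d + 2))))))
      s₁ s₂ dom := by
  have hε : 0 ≤ ε := by linarith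
  have hK : 0 ≤ 1 + Real.sqrt (192 * ((d : ℝ) * L) * (d + Fintype.card (T4AveragingDeficitWall.Plane d))) := by positivity
  have hsmall : ∀ j : ℕ, LevelSmall d L (j + 1) (ε / ((L : ℝ) ^ (j + 2)) ^ 2) := levelSmall_family hL hε h1 h2
  refine ne3EnergyRateWCov_sfClass_of_pairLandauGaugeB8Avg (by omega) (by omega) hN hb hbε hg hsmall hCP hreg₁ hν hK hbudget hB8 ?_
  intro j V hV UA UB hA hB hreg u Z hZ
  obtain ⟨X, Nn, α, αN, a, hdec, hΓ0, hα, hαN, hJ1, hJ2, hP⟩ := hsupp j V hV UA UB hA hB hreg u Z hZ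
  exact ⟨X, Nn, α, αN, a, hdec, hΓ0, hα, hαN, hJ1, hJ2, hP,
    tangentProjectionBound_slicB8_sfClass_family hd hL hN hb hε hε1 hbs hbε' h1 h2 j hreg⟩

end

end Summit.QuantumFields.BalabanUV.T4Continuum.NE3.PairLandauB8EndSfClassR25
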